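import Literature.IUT.LogThetaLattice.HodgeTheaterLogLink
import Literature.IUT.LogThetaLattice.UnitMuCoricOfThetaMonoids
import Literature.IUT.LogThetaLattice.BiCores
import HarnessLib

/-!
# [IUTchIII] Theorem 1.5 (i) (vertical coricity) and (ii) (horizontal coricity) from the references
# quoted in their statements (proof-only companion; DISCHARGE-L6 §F row F7, SUBDAG-IUTchIII-Thm-15 r2/r3)

Mochizuki, *Inter-universal Teichmüller Theory III*, kurims manuscript (May 2020), §1, Thm 1.5 (i), (ii)
p. 48; Prop 1.3 (ii) p. 42; Def 1.4 pp. 45–46; Thm 1.5 (iii) p. 49; *II*, kurims manuscript, Cor 4.10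
(iii), (iv) p. 160 [cite: Mochizuki2012, III Thm 1.5 (i)(ii) p.48; Prop 1.3 (ii) p.42; II Cor 4.10 (iv) p.160]
(D-0012 claim key, status disputed; proof-only companion over the LANDED interfaces of
`HodgeTheaterLogLink.lean` (abc-iut-L6-t3), `ThetaGauLinks.lean` / `StripFrameThetaLinks.lean`
(abc-iut-L6-t2), `UnitMuCoricOfThetaMonoids.lean` (abc-iut-L6-d1), `BiCores.lean` (abc-iut-L6-t3); no new
definition, no new `Prop`; nothing here asserts a disputed claim or takes a side on [IUTchIII] Cor 3.12).

Printed proof of Thm 1.5 (p. 51): "The various assertions of Theorem 1.5 follow immediately from the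
definitions and the references quoted in the statements of these assertions." The references quoted
in (i) and (ii) are, respectively, Prop 1.3 (ii) ("Any log-link `†HT --log--> ‡HT` induces [and may be
thought of as "lying over"] a [poly-]isomorphism `†HT^D ⥲ ‡HT^D`") and [IUTchII] Cor 4.10 (iv)
("one obtains a poly-isomorphism `†F^{⊢×μ}_△ ⥲ ‡F^{⊢×μ}_△` which coincides with the full
poly-isomorphism"). This file records those two derivations in the kernel, junction by junction:

* **(i) ⇐ Prop 1.3 (ii) + Def 1.4.** The vertical arrow `^{n,m}HT --log--> ^{n,m+1}HT` of a log-theta-lattice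
  is the FULL log-link (Def 1.4), i.e. its datum `Ξ` is the full poly-isomorphism of
  `D-Θ^{±ell}NF`-Hodge theaters; by Prop 1.3 (ii) the log-link lies over `Ξ`, and — at the level of the
  individual strip log-links `†F_□ --log--> ‡F_□` (Prop 1.3 (i)) — the induced poly-isomorphism of
  `D`-prime-strips `†D_□ ⥲ ‡D_□` (Prop 1.2 (i)) is the image of the FULL poly-isomorphism
  `†HT^D ⥲ ‡HT^D` under `HT^D ↦ D_□` (`thm15i_stripLink_inducedD_eq`, `thm15i_mem_stripLink_inducedD`);
  the vertical poly-isomorphism of Thm 1.5 (iii) (`BiCoricData.verticalPolyIso`) is by construction the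
  one induced by this full poly-isomorphism (`thm15i_verticalPolyIso_eq`).
* **(ii) ⇐ [IUTchII] Cor 4.10 (iv).** The owner's typing of Cor 4.10 (iv) is the named statement
  `HodgeTheaterStrips.UnitMuCoric` (`ThetaGauLinks.lean`): the poly-isomorphism `†F^{⊢×μ}_△ ⥲ ‡F^{⊢×μ}_△`
  obtained through either link coincides with the full one. The [IUTchIII]-side typing of Thm 1.5 (ii)
  (`LogThetaLatticeDiagram.horizontal_inducedFxm_full`) rests on the interface field
  `ThetaLinkData.induced_full` — "the poly-isomorphism induced on `F^{⊢×μ}`-prime-strips by the full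
  poly-isomorphism `†F^{⊩▶×μ}_{env/gau} ⥲ ‡F^{⊩▶×μ}_△` is full". We prove: (a) conjugating a poly-isomorphism
  by isomorphisms gives the full poly-isomorphism IFF the poly-isomorphism is full
  (`polyIsoConj_eq_full_iff`), hence (b) `UnitMuCoric` for a pair of Hodge theaters over a strip frame
  is EQUIVALENT to the `induced_full`-shaped statements for their `Θ^{×μ}`- and `Θ^{×μ}_{gau}`-links
  (`map_full_of_unitMuCoric`, `unitMuCoric_iff_map_full`) — so the [IUTchIII]-side field is exactly
  Cor 4.10 (iv) as typed by its owner, neither more nor less; (c) the interface `ThetaLinkData` is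
  INSTANTIABLE (the field `induced_full` PROVED, not postulated) from any functorial choice of pilot
  `F^{⊩▶×μ}`-prime-strips as soon as the frame-level property holds (`exists_thetaLinkData_of_map_full`),
  in particular from the [IUTchIII] Prop 2.1 / Thm 2.2 data `ThetaMonoidData` (Thm 2.2 (i):
  `Aut_{F^{⊩▶×μ}} ↠ Aut_{F^{⊢×μ}}`; abc-iut-L6-d1's `map_full_fglxmToFxm`) (`exists_thetaLinkData_of_thetaMonoidData`),
  and then Thm 1.5 (ii) holds for every log-theta-lattice over it (`thm15ii_of_thetaMonoidData`).

Typed ≠ proved: the inputs remain the interface fields they are in the owners' files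
(`StripFrame`, `LogStripData`, `ThetaMonoidData.mapAut_surjective`, `HodgeTheaterStrips`); what is
kernel-checked here is that Thm 1.5 (i), (ii) add nothing to them.
-/

namespace Literature.IUT.LogThetaLattice

open CategoryTheory
open Literature.IUT.HodgeTheaters
open Literature.IUT.HodgeArakelov

universe v u

/-! ### A. Thm 1.5 (i) from Prop 1.3 (ii) and Def 1.4 -/

section Vertical

variable {S : StripFrame.{u}} {L : LogStripData S} {T : ThetaLinkData S}
  (Λ : LogThetaLatticeDiagram L T)

/-- **IUTchIII:Thm1.5(i)** (kurims p.48) Thm 1.5 (i) read through Prop 1.3 (ii) and Def 1.4: the datum `Ξ` of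
the vertical arrow `^{n,m}HT --log--> ^{n,m+1}HT` (the full log-link, Def 1.4) is the full poly-isomorphism
of `D-Θ^{±ell}NF`-Hodge theaters, and the poly-isomorphism the log-link induces ("lies over", Prop 1.3
(ii)) is that datum. [claim: Mochizuki2012, status: disputed] -/
theorem thm15i_vertical_Xi_full (n m : ℤ) :
    (Λ.vertical n m).Ξ = PolyIso.full _ _ ∧ (Λ.vertical n m).inducedDHT = (Λ.vertical n m).Ξ :=
  ⟨Λ.vertical_isFull n m, rfl⟩

/-- **IUTchIII:Thm1.5(i)** (kurims p.48) Thm 1.5 (i) at the level of the constituent strip log-links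
`†F_□ --log--> ‡F_□` of the vertical arrow (Prop 1.3 (i)): the poly-isomorphism of `D`-prime-strips
`†D_□ ⥲ ‡D_□` it induces (Prop 1.2 (i)) is the set of isomorphisms determined by the constituents of the
FULL poly-isomorphism `^{n,m}HT^D ⥲ ^{n,m+1}HT^D` (Prop 1.3 (ii) `stripLink_inducedD` + Def 1.4).
[claim: Mochizuki2012, status: disputed] -/
theorem thm15i_stripLink_inducedD_eq (n m : ℤ) (l : S.Label) :
    ((Λ.vertical n m).stripLink l).inducedD =
      (fun ξ => dstripIso ξ l) '' PolyIso.full (S.htToD.obj (Λ.HT (n, m))) (S.htToD.obj (Λ.HT (n, m + 1))) := by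
  rw [HTLogLink.stripLink_inducedD]
  rfl

/-- **IUTchIII:Thm1.5(i)** (kurims p.48) … equivalently: an isomorphism `†D_□ ⥲ ‡D_□` belongs to the
poly-isomorphism induced by the `□`-constituent of the vertical arrow iff it is induced, through
`HT^D ↦ D_□` and the identifications `D(†F_□) = †D_□`, by SOME isomorphism of `D-Θ^{±ell}NF`-Hodge theaters
(no isomorphism being preferred: vertical coricity). [claim: Mochizuki2012, status: disputed] -/
theorem thm15i_mem_stripLink_inducedD (n m : ℤ) (l : S.Label)
    (e : S.toD.obj ((S.strip l).obj (Λ.HT (n, m))) ≅ S.toD.obj ((S.strip l).obj (Λ.HT (n, m + 1)))) :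
    e ∈ ((Λ.vertical n m).stripLink l).inducedD ↔
      ∃ ξ : S.htToD.obj (Λ.HT (n, m)) ≅ S.htToD.obj (Λ.HT (n, m + 1)),
        stripCommIso l _ ≪≫ (S.dstrip l).mapIso ξ ≪≫ (stripCommIso l _).symm = e := by
  rw [thm15i_stripLink_inducedD_eq]
  simp only [Set.mem_image, PolyIso.mem_full, true_and]
  rfl

/-- **IUTchIII:Thm1.5(i)** (kurims p.48) the induced poly-isomorphism of `D`-prime-strips at every label is
nonempty (the full poly-isomorphism of `D-Θ^{±ell}NF`-Hodge theaters is, [IUTchI] §0). [claim: Mochizuki2012, status: disputed] -/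
theorem thm15i_stripLink_inducedD_nonempty (n m : ℤ) (l : S.Label) :
    (((Λ.vertical n m).stripLink l).inducedD).Nonempty :=
  ((Λ.vertical n m).stripLink l).inducedD_nonempty

/-- **IUTchIII:Thm1.5(i)** (kurims p.48) "`… ⥲ ^{n,m}HT^D ⥲ ^{n,m+1}HT^D ⥲ …`": the `m`-th arrow of the
Frobenius-picture chain formed by the vertical line `n` (Prop 1.3 (iv)) IS the vertical arrow `(n, m)` of
the lattice, so the chain of induced poly-isomorphisms of `D-Θ^{±ell}NF`-Hodge theaters is the chain of full
poly-isomorphisms. [claim: Mochizuki2012, status: disputed] -/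
theorem thm15i_verticalChain_link (n m : ℤ) :
    (Λ.verticalChain n).link L m = Λ.vertical n m ∧
      ((Λ.verticalChain n).link L m).inducedDHT = PolyIso.full _ _ :=
  ⟨rfl, HTLogLink.Chain.inducedDHT_link L _ m⟩

/-- **IUTchIII:Thm1.5(iii)** (kurims p.49) junction (i) → (iii): the VERTICAL poly-isomorphism
`F^{⊢×μ}_△(^{n,m}D^⊢_△) ⥲ F^{⊢×μ}_△(^{n,m+1}D^⊢_△)` of Thm 1.5 (iii) (`BiCoricData.verticalPolyIso`) is the one
induced — through `†D_≻ ↦ F^{⊢×μ}_△(†D_≻)` and the natural isomorphisms `F^{⊢×μ}_△(†D_≻) ⥲ F^{⊢×μ}_△(†D^⊢_△)` — by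
the poly-isomorphism of `D-Θ^{±ell}NF`-Hodge theaters induced by the vertical arrow, i.e. by Thm 1.5 (i).
[claim: Mochizuki2012, status: disputed] -/
theorem thm15i_verticalPolyIso_eq (B : BiCoricData S) (n m : ℤ) :
    B.verticalPolyIso (S.htToD.obj (Λ.HT (n, m))) (S.htToD.obj (Λ.HT (n, m + 1))) =
      ((PolyIso.single (B.deltaIso _).symm).comp
          (((Λ.vertical n m).inducedDHT).map (S.dstrip B.succ ⋙ B.fxOfDsucc))).comp
        (PolyIso.single (B.deltaIso _)) := by
  rw [Λ.vertical_inducedDHT_full]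
  rfl

end Vertical

/-! ### B. Conjugation by isomorphisms detects fullness ([IUTchI] §0 bookkeeping) -/

section Poly

variable {C : Type u} [Category.{v} C]

/-- **IUTchII:Cor4.10(iv)** (kurims p.160) bookkeeping converse of `polyIsoConj_full`: composing a
poly-isomorphism with isomorphisms on both sides ("by composing these natural isomorphisms with the
poly-isomorphisms induced … by the links") yields the FULL poly-isomorphism if and only if the
poly-isomorphism one started from is full. [claim: Mochizuki2012, status: disputed] -/
theorem polyIsoConj_eq_full_iff {X X' Y Y' : C} (α : X' ≅ X) (P : PolyIso X Y) (β : Y ≅ Y') :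
    polyIsoConj α P β = PolyIso.full X' Y' ↔ P = PolyIso.full X Y := by
  constructor
  · intro h
    ext ψ
    simp only [PolyIso.full, Set.mem_univ, iff_true]
    have hmem : α ≪≫ ψ ≪≫ β ∈ polyIsoConj α P β := by
      rw [h]
      exact Set.mem_univ _
    obtain ⟨ψ', hψ', hEq⟩ := hmem
    have hhom := congrArg Iso.hom hEq
    simp only [Iso.trans_hom, cancel_epi, cancel_mono] at hhom
    rwa [Iso.ext hhom]
  · rintro rfl
    exact polyIsoConj_full α β

/-- **IUTchII:Cor4.10(iv)** (kurims p.160) the same in the tree's `PolyIso.single`/`PolyIso.comp`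
vocabulary ([IUTchI] §0 p.33): `{α} ∘ P ∘ {β}` is full iff `P` is full. [claim: Mochizuki2012, status: disputed] -/
theorem single_comp_comp_single_eq_full_iff {X X' Y Y' : C} (α : X' ≅ X) (P : PolyIso X Y) (β : Y ≅ Y') :
    ((PolyIso.single α).comp P).comp (PolyIso.single β) = PolyIso.full X' Y' ↔ P = PolyIso.full X Y := by
  rw [← polyIsoConj_eq_comp, polyIsoConj_eq_full_iff]

end Poly

/-! ### C. Thm 1.5 (ii) from [IUTchII] Cor 4.10 (iv) -/

section Horizontal

variable {S : StripFrame.{u}}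

/-- **IUTchII:Cor4.10(iv)** (kurims p.160) ⇒ the `induced_full` shape: if "`(−)F^{⊢×μ}_△` is an invariant of
both the `Θ^{×μ}`- and `Θ^{×μ}_{gau}`-links" for the pair `†HT`, `‡HT` (the owner's named statement
`HodgeTheaterStrips.UnitMuCoric` over the setting induced by a strip frame), then the functor
`F^{⊩▶×μ} ↦ F^{⊢×μ}` carries the FULL poly-isomorphisms `†F^{⊩▶×μ}_{env} ⥲ ‡F^{⊩▶×μ}_△` and
`†F^{⊩▶×μ}_{gau} ⥲ ‡F^{⊩▶×μ}_△` (the two links, Cor 4.10 (iii)) ONTO the full poly-isomorphism of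
`F^{⊢×μ}`-prime-strips — the exact shape of the field `ThetaLinkData.induced_full` on which the [IUTchIII]-side
typing of Thm 1.5 (ii) rests. [claim: Mochizuki2012, status: disputed] -/
theorem map_full_of_unitMuCoric (dag ddag : HodgeTheaterStrips (ThetaLinkSetting.ofStripFrame S))
    (h : dag.UnitMuCoric ddag) :
    (PolyIso.full (S.FglToFglxm.obj dag.env) (S.FglToFglxm.obj ddag.delta)).map S.FglxmToFxm =
        PolyIso.full _ _ ∧
      (PolyIso.full (S.FglToFglxm.obj dag.gau) (S.FglToFglxm.obj ddag.delta)).map S.FglxmToFxm =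
        PolyIso.full _ _ := by
  obtain ⟨h₁, h₂⟩ := h
  unfold HodgeTheaterStrips.unitMuPolyIso at h₁
  unfold HodgeTheaterStrips.unitMuGauPolyIso at h₂
  rw [polyIsoConj_eq_full_iff, polyIsoMap_eq_map] at h₁ h₂
  exact ⟨h₁, h₂⟩

/-- **IUTchII:Cor4.10(iv)** (kurims p.160) over a strip frame, for a pair of `Θ^{±ell}NF`-Hodge theaters
(through their strips): the coricity statement `UnitMuCoric` of Cor 4.10 (iv) is EQUIVALENT to the two
`induced_full`-shaped statements for the `Θ^{×μ}`- and `Θ^{×μ}_{gau}`-links (forward: this file; backward: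
the owner's reduction `unitMuCoric_of_mapIso_surjective`). [claim: Mochizuki2012, status: disputed] -/
theorem unitMuCoric_iff_map_full (dag ddag : HodgeTheaterStrips (ThetaLinkSetting.ofStripFrame S)) :
    dag.UnitMuCoric ddag ↔
      ((PolyIso.full (S.FglToFglxm.obj dag.env) (S.FglToFglxm.obj ddag.delta)).map S.FglxmToFxm =
          PolyIso.full _ _ ∧
        (PolyIso.full (S.FglToFglxm.obj dag.gau) (S.FglToFglxm.obj ddag.delta)).map S.FglxmToFxm =
          PolyIso.full _ _) := by
  refine ⟨map_full_of_unitMuCoric dag ddag, fun h => ?_⟩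
  exact dag.unitMuCoric_of_mapIso_surjective ddag
    ((mapIso_surjective_iff_map_full S.FglxmToFxm _ _).mpr h.1)
    ((mapIso_surjective_iff_map_full S.FglxmToFxm _ _).mpr h.2)

/-- **IUTchIII:Thm1.5(ii)** (kurims p.48) the interface `ThetaLinkData` of the [IUTchIII]-side typing
([IUTchII] Cor 4.10 (i)–(iv): pilot `F^{⊩▶×μ}`-prime-strips `†F^{⊩▶×μ}_△`, `†F^{⊩▶×μ}_{env}` / `†F^{⊩▶×μ}_{gau}`
attached functorially to a Hodge theater, the natural isomorphisms of unit portions, and the field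
`induced_full` = Cor 4.10 (iv)) is INSTANTIABLE — `induced_full` PROVED — from ANY functorial choice of
pilots and unit-portion isomorphisms, as soon as `F^{⊩▶×μ} ↦ F^{⊢×μ}` carries full poly-isomorphisms onto
full ones (the frame-level form of Cor 4.10 (iv), `HodgeTheaterStrips.unitMuCoric_of_map_full`).
[claim: Mochizuki2012, status: disputed] -/
theorem exists_thetaLinkData_of_map_full (pilotDelta : S.HT ⥤ S.Fglxm)
    (pilotTheta : LatticeKind → (S.HT ⥤ S.Fglxm))
    (unitPortion : ∀ k : LatticeKind, pilotDelta ⋙ S.FglxmToFxm ≅ pilotTheta k ⋙ S.FglxmToFxm)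
    (h : ∀ X Y : S.Fglxm, (PolyIso.full X Y).map S.FglxmToFxm = PolyIso.full _ _) :
    ∃ T : ThetaLinkData S, T.pilotDelta = pilotDelta ∧ T.pilotTheta = pilotTheta ∧
      T.fxmDelta = pilotDelta ⋙ S.FglxmToFxm :=
  ⟨{ pilotDelta := pilotDelta
     pilotTheta := pilotTheta
     unitPortion := unitPortion
     induced_full := fun _ _ _ => h _ _ }, rfl, rfl, rfl⟩

/-- **IUTchIII:Thm1.5(ii)** (kurims p.48) … in particular from the [IUTchIII] Prop 2.1 / Thm 2.2 data
`ThetaMonoidData` over the frame (Thm 2.2 (i): "the second arrows in each line are surjections",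
`Aut_{F^{⊩▶×μ}}(−) ↠ Aut_{F^{⊢×μ}}(−)`; frame-level consequence `map_full_fglxmToFxm`, abc-iut-L6-d1): for every
functorial choice of pilots and unit-portion isomorphisms there is a `ThetaLinkData` with these pilots
whose `induced_full` is a theorem. [claim: Mochizuki2012, status: disputed] -/
theorem exists_thetaLinkData_of_thetaMonoidData (TM : ThetaMonoidData S) (pilotDelta : S.HT ⥤ S.Fglxm)
    (pilotTheta : LatticeKind → (S.HT ⥤ S.Fglxm))
    (unitPortion : ∀ k : LatticeKind, pilotDelta ⋙ S.FglxmToFxm ≅ pilotTheta k ⋙ S.FglxmToFxm) :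
    ∃ T : ThetaLinkData S, T.pilotDelta = pilotDelta ∧ T.pilotTheta = pilotTheta ∧
      T.fxmDelta = pilotDelta ⋙ S.FglxmToFxm :=
  exists_thetaLinkData_of_map_full pilotDelta pilotTheta unitPortion (map_full_fglxmToFxm TM)

/-- **IUTchIII:Thm1.5(ii)** (kurims p.48) the pilots of Prop 2.1 (ii) / [IUTchII] Cor 4.10 (ii) themselves: with
`†F^{⊩▶×μ}_{env} := F^{⊩▶×μ}(†F^⊩_{env})` (`ThetaMonoidData.FglEnvHT ⋙ FglToFglxm`, the non-Gaussian pilot; cf.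
`LatticeGlue.pilotEnv_iso`) and ANY Gaussian pilot / `△`-pilot functors with unit-portion isomorphisms, a
`ThetaLinkData` exists whose non-Gaussian pilot IS the theta-monoid one. [claim: Mochizuki2012, status: disputed] -/
theorem exists_thetaLinkData_pilotEnv (TM : ThetaMonoidData S) (pilotDelta pilotGau : S.HT ⥤ S.Fglxm)
    (unitEnv : pilotDelta ⋙ S.FglxmToFxm ≅ (TM.FglEnvHT ⋙ S.FglToFglxm) ⋙ S.FglxmToFxm)
    (unitGau : pilotDelta ⋙ S.FglxmToFxm ≅ pilotGau ⋙ S.FglxmToFxm) :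
    ∃ T : ThetaLinkData S, T.pilotDelta = pilotDelta ∧
      T.pilotTheta LatticeKind.nonGaussian = TM.FglEnvHT ⋙ S.FglToFglxm ∧
      T.pilotTheta LatticeKind.gaussian = pilotGau := by
  obtain ⟨T, hD, hT, -⟩ := exists_thetaLinkData_of_thetaMonoidData TM pilotDelta
    (fun k => match k with
      | LatticeKind.nonGaussian => TM.FglEnvHT ⋙ S.FglToFglxm
      | LatticeKind.gaussian => pilotGau)
    (fun k => match k with
      | LatticeKind.nonGaussian => unitEnv
      | LatticeKind.gaussian => unitGau)
  exact ⟨T, hD, by rw [hT], by rw [hT]⟩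

/-- **IUTchIII:Thm1.5(ii)** (kurims p.48) **Thm 1.5 (ii) (Horizontal Coricity) with `induced_full` DISCHARGED**:
over a frame carrying the Prop 2.1 / Thm 2.2 data, for every functorial choice of pilots there is a
`ThetaLinkData` with those pilots such that, for EVERY log-theta-lattice over it (either kind) and every
horizontal arrow `^{n,m}HT → ^{n+1,m}HT`, the induced poly-isomorphism `^{n,m}F^{⊢×μ}_△ ⥲ ^{n+1,m}F^{⊢×μ}_△` is the
full poly-isomorphism. [claim: Mochizuki2012, status: disputed] -/
theorem thm15ii_of_thetaMonoidData (TM : ThetaMonoidData S) (pilotDelta : S.HT ⥤ S.Fglxm)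
    (pilotTheta : LatticeKind → (S.HT ⥤ S.Fglxm))
    (unitPortion : ∀ k : LatticeKind, pilotDelta ⋙ S.FglxmToFxm ≅ pilotTheta k ⋙ S.FglxmToFxm) :
    ∃ T : ThetaLinkData S, T.pilotDelta = pilotDelta ∧ T.pilotTheta = pilotTheta ∧
      ∀ (L : LogStripData S) (Λ : LogThetaLatticeDiagram L T) (n m : ℤ),
        T.linkInducedFxm Λ.kind (Λ.HT (n, m)) (Λ.HT (n + 1, m)) =
          PolyIso.full (Λ.fxmDelta (n, m)) (Λ.fxmDelta (n + 1, m)) := by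
  obtain ⟨T, hD, hT, -⟩ := exists_thetaLinkData_of_thetaMonoidData TM pilotDelta pilotTheta unitPortion
  exact ⟨T, hD, hT, fun L Λ n m => Λ.horizontal_inducedFxm_full n m⟩

/-- **IUTchIII:Thm1.5(ii)** (kurims p.48) Thm 1.5 (ii) read on the [IUTchII] side (Cor 4.10 (vi) chains of
`Θ^{×μ}_{gau}`-links through their strips): along an infinite chain of Hodge theaters over the frame-induced
setting, every horizontal arrow has coric `F^{⊢×μ}`-prime-strips, and the induced poly-isomorphisms of
`F^{⊢×μ}`-prime-strips through BOTH links are the full ones (Cor 4.10 (iv) ⇐ Thm 2.2 (i), abc-iut-L6-d1,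
unfolded by `map_full_of_unitMuCoric`). [claim: Mochizuki2012, status: disputed] -/
theorem thm15ii_chain_map_full (TM : ThetaMonoidData S)
    (P : ThetaGauChain (ThetaLinkSetting.ofStripFrame S)) (n : ℤ) :
    (PolyIso.full (S.FglToFglxm.obj (P.theater n).env) (S.FglToFglxm.obj (P.theater (n + 1)).delta)).map
          S.FglxmToFxm = PolyIso.full _ _ ∧
      (PolyIso.full (S.FglToFglxm.obj (P.theater n).gau) (S.FglToFglxm.obj (P.theater (n + 1)).delta)).map
          S.FglxmToFxm = PolyIso.full _ _ :=
  map_full_of_unitMuCoric _ _ (unitMuCoric_chain TM P n)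

end Horizontal

end Literature.IUT.LogThetaLattice
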